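import Literature.MathematicalPhysics.QuantumFieldTheory.Balaban1983to89.Node00.TorusCoverGaugeTokensR
import Literature.MathematicalPhysics.QuantumFieldTheory.Balaban1983to89.B8Thm4TruncationLocal
import Literature.MathematicalPhysics.QuantumFieldTheory.Balaban1983to89.B8SockH59CornerDefect
import Literature.MathematicalPhysics.QuantumFieldTheory.Balaban1983to89.B7Prop4GeneralCk

/-!
# K0⁷ STUB 2 (`stub_prop6MemberB8At13`) — ITS INDEX-FREE NORMAL FORM («[6] Prop. 6 at EVERY bare cube datum under the MINIMAL smallness»)
# and the CARRIER ∕ JUNCTION CERTIFICATE (the K0 consumer's cubes `Node00.propCube` — collar `ρ = L` — lie OUTSIDE the p. 98 side conditions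
# of N05's per-cube Proposition-6 letters of record, for ALL thresholds)

Cell `pub-ymgap`, seat `pub-ymgap-k0-s2-w2` g0 (K0⁷ stub-2 width seat 2∕2, director-ym №197 ∕ HUMAN RULING D-0149).  Key K0⁷
**stmt-QuantumFields-20541** (`Record13SepCoPHInhabited`), `--kind proof --supports stmt-QuantumFields-20541 --as helper`.
[6] = [Balaban1985RegularSpaces] (Prop. 6 p. 99, p. 98); [15] = [Balaban1985Variational] ((144)–(152) pp. 300–301).

THE STUB (plan g77 V18 `K0Skeleton13SepCoPHV18.lean` 3bcb71246bb7298d, stub 2, UNCHANGED since V14):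
`Prop6MemberB8At F := ∃ B₁ c₁, 0 ≤ B₁ ∧ 0 < c₁ ∧ B8.Prop6Printed 4 L B₁ c₁ (fun i : ZdIdx 4 F.L => zdCub (MatA 2) F.L i)` — [6] Proposition 6 at
node00-def-cube's `ℤ⁴ × M₂(ℂ)` member over n05-a's WHOLE index: every ambient member `i : ZdIdx 4 F.L`, every cube datum `c : Node00.CubeB8 4 L i.k i.Ω`
(laws `1 ≤ k ≤ K`, `L ≤ ρ ≤ M`, `11d < M`, `L ≤ dM`, `□ ⊂ Ω_k`, `□̃ ⊂ Ω_{k−1}` ONLY).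

WHAT THIS FILE PROVES (kernel; theorems only, 0 `def`).
§1 `gaugedBoundB8_iff_of_data_eq` — `Node00.GaugedBoundB8 L η U₀ c r` reads ONLY the data `(k, a, M, ρ)` of `c` (two cube data over ANY two ambient
   families with the same four numbers carry the same sentence; definitional proof irrelevance).  `Ω_subset_of_le` (an ambient family is antitone in the
   level).  `condAt_tcube_of_inAk` ∕ `condAt_box_of_inAk` — an ambient `U₀ ∈ 𝔄_K({Ω_j}, α₀)` gives EXACTLY: the level-`j` conditions (1.7)∕(1.9) on the
   collared cube `□̃ = tcube` for `j < c.k` and the level-`c.k` conditions on `□ = box` (the MINIMAL smallness a cube datum ever sees: `□̃ ⊂ Ω_{k−1} ⊂ Ω_j`,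
   `□ ⊂ Ω_k`; [6] p. 98 «we can drop out the domains Ω_{j′}, j′ > j»).
§2 ★ `prop6Printed_zdCub_of_minimal` (SUPPLIER NORMAL FORM): if for every spacing `η > 0`, every cube datum `c` (over any ambient family), every unitary `U₀`
   with the MINIMAL smallness and «`7dL²·M·α₀ ≤ c₁`» one has `GaugedBoundB8 L η U₀ c (7dL²B₁·M·α₀)`, then `B8.Prop6Printed d L B₁ c₁ (zdCub 𝔸 L ∘ f)` for
   EVERY index map `f` (in particular stub 2's body at `f = id`, `d = 4`, `𝔸 = M_N(ℂ)`).
   ★ `gaugedBoundB8_of_prop6Printed_zdCub_minimal` (THE CONVERSE): the member sentence over the whole index FORCES Prop. 6 at EVERY cube datum under the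
   minimal smallness (the ambient member with levels `□̃, …, □̃, □` is built inside the proof — it IS a lawful `ZdIdx` member carrying the datum).
   ★★ `prop6Printed_zdCub_iff_minimal` — hence stub 2's body is EQUIVALENT to the bare-datum sentence: «for every `η > 0`, `k ≥ 1`, corner `a`, side `M`,
   collar `ρ` with `L ≤ ρ ≤ M`, `11d < M`, `L ≤ dM`, every unitary `U₀` with `|U₀(∂p) − 1| < α₀L^{−2j}`, `|D*∂U₀| < α₀L^{−2j}(Lʲη)⁻¹` on `□̃` (`j < k`) and on
   `□` (`j = k`), and `7dL²Mα₀ ≤ c₁`: (1.135)–(1.138) with `7dL²B₁Mα₀`» — collars DOWN TO `ρ = L`, sides NOT multiples of anything, NO big-block alignment.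
   `prop6MemberAt_iff_minimal` — the same at the K0 letters (`d = 4`, `𝔸 = MatA N`, `L = F.L`).
§2c `localGauge_one` · ★ `gaugedBoundB8_one` (NON-VACUITY OF THE CONCLUSION at every datum, thin collars included): at `U₀ = 1` the eleven clauses
   (1.135)–(1.138) hold with `u = 1` for every `r ≥ 0` (`U₀″ = 1`, `A = 0`, (1.29)∕(1.38) for `1`, `w = 1`, all weighted norms `0`, (1.137) reads `0 = log 1`)
   — no clause of `GaugedBoundB8` is contradictory by itself at any `CubeB8` datum; the content of stub 2 is the passage from `U₀ = 1` to `U₀ ∈ 𝔄_k(α₀)`.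
§3 ★ `propCube_not_printSide_dvd` ∕ `propCube_not_printSide_collar` ∕ `not_printSide_of_rho_lt` (CARRIER ∕ JUNCTION CERTIFICATE, arithmetic): the cubes the K0
   consumer `Node00.gauge152R_of_prop6` instantiates (`Node00.propCube P n hn M a`: `ρ = L`, side `M + 11d + L`) satisfy NEITHER `∃ Mh ≥ 3, Mh·L ∣ ρ` NOR
   `∃ Mh ≥ 3, ∃ R ≥ 2L, R·(Mh·L) ≤ ρ` — two of the displayed p. 98 side conditions («M a multiple of R₁M₁», «collar R₁M₁», big blocks `Mh·L`) under which
   N05's per-cube Proposition-6 letters of record conclude (`B8Prop6CubeMemberScalarBdryBetaPrinted.gaugedBoundB8_cubeMember_scalar_bdryβ_printed`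
   p569918, `…ScalarBdryBetaOfGBound` p563641, and every edition-γ successor keeping that binder list); generally NO cube with `ρ < 3L` (resp. `ρ < 6L²`)
   meets them.  So the per-cube road of record can feed stub 2 ONLY at cubes the K0 road never reads, and NEVER at the cubes it reads — for every
   value of the thresholds `ρ₀ M₀ N₀`.

LOCATED (K0 side; for plan g77 ∕ dag-lead ∕ dag-n07-e; n05-e LOCATED-CARRIER I.22591 read from the consumer's end).  By §2 stub 2 = [6] Prop. 6 at ALL
collars `ρ ≥ L` and ragged sides; print p. 98 treats `ρ = R₁M₁`, `M ∈ R₁M₁ℕ`, `□_j` unions of big blocks, «R₁, M₁ smallest integers for which all the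
theorems of [2, 4] are valid» — so the stub is WIDER than print in the cube GEOMETRY, and by §3 the K0 consumer needs precisely the wide part (`ρ = L`).
No road in the tree (junction road via [B9] Thm 3.3 sockets; flat road via the scalar (1.59) clauses) reaches thin collars with a printed proof behind it.
REPAIR CENSUS (planner's call, not this file's): (R-a) keep the text and book stub 2 as beyond-print (like 3ᴬ); (R-b) parametrise the collar ∕ big-block
size `ρ₀ = R₁M₁` in `Node00.CubeB8`∕`zdCub` and in n07-e's `propCube` (collar `ρ₀`, aligned side), floor `(11d + 3L)·L ↦` a function of `ρ₀` (and of the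
supplier's thresholds), stub 2′ := `∃ ρ₀ B₁ c₁, …` on print's class — then the per-cube road applies above threshold.

HONEST FRAMING: bookkeeping and decidable arithmetic about TREE-typed sentences; nothing of Bałaban is asserted, proved or refuted here; stub 2 is NEITHER
proved NOR refuted; K0⁷ OPEN; N05 ∕ N07 NOT discharged; counts unmoved (typed 28∕28 · discharged 5∕27); one finite `𝕋⁴` programme at fixed `ε = L^{−K}`;
the YM mass gap (Clay) is NOT proved by any of this — R4 closes the conditional finite-`𝕋⁴` rung `BalabanLadder.UV` only; nothing continuum ∕ ℝ⁴ ∕ OS.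
THEOREMS ONLY: no `def`, `instance`, `notation`, `sorry`; standard axioms; default heartbeats.
-/

noncomputable section

open scoped Matrix.Norms.L2Operator

namespace Summit.QuantumFields.YangMills.Theorems.K0Stub2DatumForm

open Literature.MathematicalPhysics.QuantumFieldTheory.Balaban1983to89
open Literature.MathematicalPhysics.QuantumFieldTheory.Balaban1983to89.Node00
open Literature.MathematicalPhysics.QuantumFieldTheory.Balaban1983to89.T4Continuum
open B7Prop1Explicit (Site)
open B7Prop1Local (InBox)
open B7Prop2Explicit (unitaryUnits)
open B8LeafModelZd (ZdIdx)
open B8Ineq132 (InAk CondAt condAt_anti)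
open B8Eq131Cubes (box tcube cube_subset_tcube)
open B7Prop1Explicit (gaugeAct)
open B7Prop1Local (clampCfg)
open B8Ineq130 (tlo thi)
open B8Ineq132 (covDerivFwd)
open B8Eq143PlaqExpansion (pdiv)
open B8Eq146AExpansion (iEta plaqCovDeriv)
open B8Eq184Proof (cfgExp)
open B8ScaledSupNorm (msup bondNorm msup_le bondNorm_zero)

/-! ## §1  `GaugedBoundB8` reads only the datum; the minimal smallness an ambient family hands to a cube -/

section Datum

variable {d : ℕ} {𝔸 : Type*} [CStarAlgebra 𝔸]

/-- **`GaugedBoundB8 L η U₀ c r` DEPENDS ON THE CUBE ONLY THROUGH ITS DATA `(k, a, M, ρ)`**: two `CubeB8` data over arbitrary ambient families `(K, Ω)`,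
`(K′, Ω′)` with the same scale index, corner, side and collar carry the same sentence (1.135)–(1.138) (the law fields are propositions; every letter of
`GaugedBoundB8` — `c.sq = cubeFam false L a M ρ k`, `c.lamS`, `c.vfix`, `c.fixed`, `c.expo` — is spelled from the four numbers).
[cite: Balaban1985RegularSpaces, Prop. 6 (1.135)–(1.138) p.99 (bookkeeping)] -/
theorem gaugedBoundB8_iff_of_data_eq (L : ℕ) {K K' : ℕ} {Ω Ω' : ℕ → Set (Site d)} (η : ℝ) (U₀ : Site d → Fin d → 𝔸ˣ)
    (c : CubeB8 d L K Ω) (c' : CubeB8 d L K' Ω') (hk : c.k = c'.k) (ha : c.a = c'.a) (hM : c.M = c'.M) (hρ : c.ρ = c'.ρ) (r : ℝ) :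
    GaugedBoundB8 L η U₀ c r ↔ GaugedBoundB8 L η U₀ c' r := by
  obtain ⟨k, a, M, ρ, h1, h2, h3, h4, h5, h6, h7, h8⟩ := c
  obtain ⟨k', a', M', ρ', h1', h2', h3', h4', h5', h6', h7', h8'⟩ := c'
  simp only at hk ha hM hρ
  subst hk ha hM hρ
  exact Iff.rfl

/-- An ambient family `{Ω_j}` of n05-a's index is antitone in the level: `Ω_{j′} ⊆ Ω_j` for `j ≤ j′` ((1.3) «Ω₀ ⊃ Ω₁ ⊃ … ⊃ Ω_k»).
[cite: Balaban1985RegularSpaces, (1.3) p.77] -/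
theorem Ω_subset_of_le {Ω : ℕ → Set (Site d)} (hΩ : ∀ j, Ω (j + 1) ⊆ Ω j) {j j' : ℕ} (hjj' : j ≤ j') : Ω j' ⊆ Ω j :=
  (antitone_nat_of_succ_le hΩ) hjj'

/-- **THE MINIMAL SMALLNESS BELOW THE TOP LEVEL**: for a cube `c` of an antitone ambient family and `U₀ ∈ 𝔄_K({Ω_j}, α)`, the level-`j` conditions
(1.7)∕(1.9) hold on the collared cube `□̃ = tcube` for every `j < c.k` (`□̃ ⊂ Ω_{k−1} ⊂ Ω_j`). [cite: Balaban1985RegularSpaces, (1.7)–(1.9) p.77, p.98 («we have □̃ ⊂ Ω_{k−1}»)] -/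
theorem condAt_tcube_of_inAk {L K : ℕ} {Ω : ℕ → Set (Site d)} (hΩ : ∀ j, Ω (j + 1) ⊆ Ω j) (c : CubeB8 d L K Ω) {η α : ℝ}
    {U₀ : Site d → Fin d → 𝔸ˣ} (h : InAk L K η α Ω U₀) {j : ℕ} (hj : j < c.k) :
    CondAt L η α j (tcube L c.a c.M c.ρ c.k) U₀ :=
  condAt_anti (c.tcube_sub.trans (Ω_subset_of_le hΩ (by omega))) (h j (by have := c.k_le; omega))

/-- **THE MINIMAL SMALLNESS AT THE TOP LEVEL**: the level-`c.k` conditions (1.7)∕(1.9) hold on `□ = box` (`□ ⊂ Ω_k`). [cite: Balaban1985RegularSpaces, (1.7)–(1.9) p.77, p.98 («□ is contained in Ω_j»)] -/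
theorem condAt_box_of_inAk {L K : ℕ} {Ω : ℕ → Set (Site d)} (c : CubeB8 d L K Ω) {η α : ℝ}
    {U₀ : Site d → Fin d → 𝔸ˣ} (h : InAk L K η α Ω U₀) :
    CondAt L η α c.k (box L c.a c.M c.k) U₀ :=
  condAt_anti c.box_sub (h c.k c.k_le)

end Datum

/-! ## §2  The member sentence over the whole index ⟺ Proposition 6 at every bare datum under the minimal smallness -/

section NormalForm

variable {d : ℕ} {𝔸 : Type} [CStarAlgebra 𝔸]

/-- ★ **SUPPLIER NORMAL FORM**: Proposition 6's (1.135)–(1.138) at every cube datum (over any ambient family) for every unitary `U₀` under the MINIMAL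
smallness — level-`j` conditions on `□̃` for `j < k`, level-`k` conditions on `□` — and «`7dL²Mα₀ ≤ c₁`» IMPLIES the member sentence
`B8.Prop6Printed d L B₁ c₁ (zdCub 𝔸 L ∘ f)` for every index map `f` (an ambient `U₀ ∈ 𝔄_K({Ω_j}, α₀)` hands the cube exactly the minimal smallness, §1).
[cite: Balaban1985RegularSpaces, Prop. 6 (1.135)–(1.138) p.99, (1.7)–(1.9) p.77, p.98] -/
theorem prop6Printed_zdCub_of_minimal {L : ℕ} {B₁ c₁ : ℝ}
    (H : ∀ (η : ℝ), 0 < η → ∀ {K : ℕ} {Ω : ℕ → Set (Site d)} (c : CubeB8 d L K Ω) (α₀ : ℝ), 0 < α₀ →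
      ∀ (U₀ : Site d → Fin d → 𝔸ˣ), (∀ x κ, U₀ x κ ∈ unitaryUnits 𝔸) →
      (∀ j, j < c.k → CondAt L η α₀ j (tcube L c.a c.M c.ρ c.k) U₀) → CondAt L η α₀ c.k (box L c.a c.M c.k) U₀ →
      7 * d * (L : ℝ) ^ 2 * c.M * α₀ ≤ c₁ → GaugedBoundB8 L η U₀ c (7 * d * (L : ℝ) ^ 2 * B₁ * c.M * α₀))
    {ι : Type} (f : ι → ZdIdx d L) :
    B8.Prop6Printed d (L : ℝ) B₁ c₁ (fun j => zdCub 𝔸 L (f j)) := by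
  rw [prop6Printed_zdCub_iff]
  intro j α₀ hα U₀ hInA c hs
  exact H (f j).η (f j).hη c α₀ hα U₀.1 U₀.2 (fun j' hj' => condAt_tcube_of_inAk (f j).hΩ c hInA hj') (condAt_box_of_inAk c hInA) hs

/-- ★ **THE CONVERSE**: the member sentence `B8.Prop6Printed d L B₁ c₁ (zdCub 𝔸 L ·)` over n05-a's WHOLE index FORCES Proposition 6's (1.135)–(1.138) at
EVERY cube datum `c` (over any ambient family: only `(k, a, M, ρ)` is read, §1) for every unitary `U₀` under the MINIMAL smallness — because the family
`(□̃, …, □̃, □)` (levels `j < k` all equal to `□̃`, top level `□`; constraint data: the single sites of `□̃` at level `0`, no constraint bonds — the pattern of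
n07-e's `Node00.constIdx`) IS a lawful member of `ZdIdx d L` carrying the datum, and there `𝔄_k` asks exactly the minimal smallness.
[cite: Balaban1985RegularSpaces, Prop. 6 (1.135)–(1.138) p.99, (1.3)–(1.9) p.77, p.98 («we can drop out the domains Ω_{j′}, j′ > j»)] -/
theorem gaugedBoundB8_of_prop6Printed_zdCub_minimal {L : ℕ} {B₁ c₁ : ℝ}
    (hP6 : B8.Prop6Printed d (L : ℝ) B₁ c₁ (fun i : ZdIdx d L => zdCub 𝔸 L i))
    (η : ℝ) (hη : 0 < η) {K : ℕ} {Ω : ℕ → Set (Site d)} (c : CubeB8 d L K Ω) (α₀ : ℝ) (hα : 0 < α₀)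
    (U₀ : Site d → Fin d → 𝔸ˣ) (hU : ∀ x κ, U₀ x κ ∈ unitaryUnits 𝔸)
    (hlow : ∀ j, j < c.k → CondAt L η α₀ j (tcube L c.a c.M c.ρ c.k) U₀) (htop : CondAt L η α₀ c.k (box L c.a c.M c.k) U₀)
    (hs : 7 * d * (L : ℝ) ^ 2 * c.M * α₀ ≤ c₁) :
    GaugedBoundB8 L η U₀ c (7 * d * (L : ℝ) ^ 2 * B₁ * c.M * α₀) := by
  -- the minimal ambient family `(□̃, …, □̃, □)` and its member of `ZdIdx d L`
  have hbt : box L c.a c.M c.k ⊆ tcube L c.a c.M c.ρ c.k := box_subset_tcube_of_le L c.a le_rfl c.ρ c.k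
  let Ωm : ℕ → Set (Site d) := fun j => if j < c.k then tcube L c.a c.M c.ρ c.k else box L c.a c.M c.k
  have hΩm_lt : ∀ j, j < c.k → Ωm j = tcube L c.a c.M c.ρ c.k := fun j hj => if_pos hj
  have hΩm_top : Ωm c.k = box L c.a c.M c.k := if_neg (lt_irrefl _)
  have hΩm0 : Ωm 0 = tcube L c.a c.M c.ρ c.k := hΩm_lt 0 c.one_le_k
  have hΩm_anti : ∀ j, Ωm (j + 1) ⊆ Ωm j := by
    intro j
    by_cases h1 : j + 1 < c.k
    · rw [hΩm_lt _ h1, hΩm_lt _ (by omega)]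
    · by_cases h0 : j < c.k
      · simp only [Ωm, if_neg h1, if_pos h0]; exact hbt
      · simp only [Ωm, if_neg h1, if_neg h0]; exact le_rfl
  let i : ZdIdx d L :=
    { η := η
      hη := hη
      k := c.k
      hk := c.one_le_k
      Ω := Ωm
      hΩ := hΩm_anti
      Λs := fun _ j => if j = 0 then tcube L c.a c.M c.ρ c.k else ∅
      Λb := fun _ _ => ∅
      hbox := fun _ _ _ _ b hb => (Set.notMem_empty b hb).elim
      hclass := fun _ _ _ _ b hb => (Set.notMem_empty b hb).elim
      htower := by
        intro j _ y hy x hx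
        by_cases hj : j = 0
        · subst hj
          rw [if_pos rfl] at hy
          have hxy : x = y := funext fun l => le_antisymm (hx l).2 (hx l).1
          rw [hxy]
          show y ∈ Ωm 0
          rw [hΩm0]; exact hy
        · rw [if_neg hj] at hy
          exact (Set.notMem_empty y hy).elim
      hpart := fun x hx => ⟨0, Nat.zero_le _, x, by rw [if_pos rfl]; exact (show x ∈ Ωm 0 from hx) |> fun h => by rwa [hΩm0] at h,
        fun l => ⟨le_rfl, le_rfl⟩⟩ }
  -- the datum as a cube of that member
  let c₀ : CubeB8 d L i.k i.Ω :=
    ⟨c.k, c.a, c.M, c.ρ, c.one_le_k, le_rfl, c.L_le_ρ, c.ρ_le_M, c.big, c.L_le_dM,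
      by show box L c.a c.M c.k ⊆ Ωm c.k; rw [hΩm_top],
      by show tcube L c.a c.M c.ρ c.k ⊆ Ωm (c.k - 1); rw [hΩm_lt _ (by have := c.one_le_k; omega)]⟩
  -- the member's `𝔄_k` is the minimal smallness
  have hInAk : InAk L i.k i.η α₀ i.Ω U₀ := by
    intro j hj
    show CondAt L η α₀ j (Ωm j) U₀
    rcases Nat.lt_or_ge j c.k with hjk | hjk
    · rw [hΩm_lt j hjk]; exact hlow j hjk
    · have : j = c.k := le_antisymm hj hjk
      subst this
      rw [hΩm_top]; exact htop
  have hG : GaugedBoundB8 L i.η U₀ c₀ (7 * d * (L : ℝ) ^ 2 * B₁ * c₀.M * α₀) :=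
    (prop6Printed_zdCub_iff (fun i : ZdIdx d L => i) B₁ c₁).1 hP6 i α₀ hα ⟨U₀, hU⟩ hInAk c₀ hs
  exact (gaugedBoundB8_iff_of_data_eq L η U₀ c c₀ rfl rfl rfl rfl _).2 hG

/-- ★★ **STUB 2's BODY IN NORMAL FORM**: the member sentence over n05-a's whole index `ZdIdx d L` is EQUIVALENT to «Proposition 6's (1.135)–(1.138) at
every cube datum `(η > 0; 1 ≤ k ≤ K; a; L ≤ ρ ≤ M, 11d < M, L ≤ dM)` of any ambient family, for every unitary `U₀` with the level-`j` conditions (1.7)∕(1.9)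
on `□̃` (`j < k`) and the level-`k` conditions on `□`, whenever `7dL²Mα₀ ≤ c₁`, with the bound `7dL²B₁Mα₀`» — collars down to `ρ = L`, ragged sides, no
big-block alignment; the ambient member is IRRELEVANT. [cite: Balaban1985RegularSpaces, Prop. 6 (1.135)–(1.138) p.99, p.98, (1.3)–(1.9) p.77] -/
theorem prop6Printed_zdCub_iff_minimal {L : ℕ} (B₁ c₁ : ℝ) :
    B8.Prop6Printed d (L : ℝ) B₁ c₁ (fun i : ZdIdx d L => zdCub 𝔸 L i) ↔
      ∀ (η : ℝ), 0 < η → ∀ {K : ℕ} {Ω : ℕ → Set (Site d)} (c : CubeB8 d L K Ω) (α₀ : ℝ), 0 < α₀ →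
        ∀ (U₀ : Site d → Fin d → 𝔸ˣ), (∀ x κ, U₀ x κ ∈ unitaryUnits 𝔸) →
        (∀ j, j < c.k → CondAt L η α₀ j (tcube L c.a c.M c.ρ c.k) U₀) → CondAt L η α₀ c.k (box L c.a c.M c.k) U₀ →
        7 * d * (L : ℝ) ^ 2 * c.M * α₀ ≤ c₁ → GaugedBoundB8 L η U₀ c (7 * d * (L : ℝ) ^ 2 * B₁ * c.M * α₀) :=
  ⟨fun hP6 η hη _ _ c α₀ hα U₀ hU hlow htop hs => gaugedBoundB8_of_prop6Printed_zdCub_minimal hP6 η hη c α₀ hα U₀ hU hlow htop hs,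
    fun H => prop6Printed_zdCub_of_minimal H fun i : ZdIdx d L => i⟩

end NormalForm

/-! ## §2b  The same at the K0 letters (`d = 4`, `𝔸 = M_N(ℂ)`, `L = F.L`) -/

section K0Letters

variable (F : T4Family) (N : ℕ)

/-- **STUB 2's BODY AT THE K0 LETTERS, NORMAL FORM** (`d = 4`, `𝔸 = MatA N` with NODE 00's C⋆-structure, `L = F.L ≥ 2`): plan V18's
`Prop6MemberB8At F` (at `N = 2`) holds with constants `(B₁, c₁)` iff Proposition 6's (1.135)–(1.138) hold at EVERY cube datum of `ℤ⁴` under the minimal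
smallness with `7·4·L²·B₁·M·α₀` (`L = F.L`). [cite: Balaban1985RegularSpaces, Prop. 6 (1.135)–(1.138) p.99, p.98] -/
theorem prop6MemberAt_iff_minimal (B₁ c₁ : ℝ) :
    (letI : CStarAlgebra (MatA N) := {};
      B8.Prop6Printed 4 (F.L : ℝ) B₁ c₁ (fun i : ZdIdx 4 F.L => zdCub (MatA N) F.L i)) ↔
    (letI : CStarAlgebra (MatA N) := {};
      ∀ (η : ℝ), 0 < η → ∀ {K : ℕ} {Ω : ℕ → Set (Site 4)} (c : CubeB8 4 F.L K Ω) (α₀ : ℝ), 0 < α₀ →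
        ∀ (U₀ : Site 4 → Fin 4 → (MatA N)ˣ), (∀ x κ, U₀ x κ ∈ unitaryUnits (MatA N)) →
        (∀ j, j < c.k → CondAt F.L η α₀ j (tcube F.L c.a c.M c.ρ c.k) U₀) → CondAt F.L η α₀ c.k (box F.L c.a c.M c.k) U₀ →
        7 * (4 : ℕ) * (F.L : ℝ) ^ 2 * c.M * α₀ ≤ c₁ → GaugedBoundB8 F.L η U₀ c (7 * (4 : ℕ) * (F.L : ℝ) ^ 2 * B₁ * c.M * α₀)) := by
  letI : CStarAlgebra (MatA N) := {}
  exact prop6Printed_zdCub_iff_minimal (𝔸 := MatA N) B₁ c₁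

end K0Letters


/-! ## §2c  Non-vacuity of the CONCLUSION at every datum: the trivial configuration is in its own gauge of record -/

section FlatWitness

variable {d : ℕ} {𝔸 : Type*} [CStarAlgebra 𝔸] [Nontrivial 𝔸]

omit [Nontrivial 𝔸] in
/-- At the trivial background the local (tower-axial) gauge of p. 98 is trivial: `localGauge … 1 … = 1` (the clamped extension of `1` is `1` and
its tower gauge is `1` — the pattern of n05-c's `B8SockH59CornerDefect.cutFixed_one`). [cite: Balaban1985RegularSpaces, p.98 (definition of U₀′)] -/
theorem localGauge_one (L : ℕ) (lo hi : Site d) (k : ℕ) (y : Site d) :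
    B8Eq115GaugeFixing.localGauge L lo hi (1 : Site d → Fin d → 𝔸ˣ) k y = 1 := by
  have hcl : clampCfg (tlo L lo k) (thi L hi k) (1 : Site d → Fin d → 𝔸ˣ) = 1 := by
    funext x κ; unfold clampCfg; split_ifs <;> rfl
  show B8Eq115GaugeFixing.towerGauge L (clampCfg (tlo L lo k) (thi L hi k) 1) k y = 1
  rw [hcl, B8Eq119TwistedAxial.towerGauge_one]

/-- ★ **THE ELEVEN CLAUSES (1.135)–(1.138) HOLD AT `U₀ = 1` WITH `u = 1`, AT EVERY CUBE DATUM AND EVERY `r ≥ 0`** (`η > 0`) — non-vacuity of the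
CONCLUSION of stub 2's normal form at every datum, thin collars included: `U₀″ = 1` (`cutFixed_one`), `U₁ = 1`, `A = 0` (`logCfg_one`), (1.29) for `u = 1`
(`restr129_one`), (1.138) for `W = 1` (`isLandau138W_one`), `w = v⁻¹u = 1`, all weighted norms of `0` vanish, and (1.137)'s identity reads `0 = log 1`.
So no clause of `GaugedBoundB8` is contradictory by itself at any `CubeB8` datum; the content of stub 2 is the passage from `U₀ = 1` to `U₀ ∈ 𝔄_k(α₀)`.
[cite: Balaban1985RegularSpaces, Prop. 6 (1.135)–(1.138) p.99, (1.27) p.80 («the configuration 1 … satisfies trivially»)] -/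
theorem gaugedBoundB8_one (L : ℕ) {K : ℕ} {Ω : ℕ → Set (Site d)} {η : ℝ} (hη : 0 < η) (c : CubeB8 d L K Ω) {r : ℝ} (hr : 0 ≤ r) :
    GaugedBoundB8 L η (1 : Site d → Fin d → 𝔸ˣ) c r := by
  classical
  -- the objects at the trivial background
  have hv : c.vfix (1 : Site d → Fin d → 𝔸ˣ) = 1 := localGauge_one L _ _ c.k _
  have hd : c.dprime (1 : Site d → Fin d → 𝔸ˣ) = 1 := B8SockH59CornerDefect.cutFixed_one L _ _ c.k _
  have hf : c.fixed (1 : Site d → Fin d → 𝔸ˣ) 1 = 1 := by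
    show gaugeAct (1 : Site d → 𝔸ˣ)⁻¹ (c.dprime (1 : Site d → Fin d → 𝔸ˣ)) = 1
    rw [hd, inv_one, B8Ineq130.gaugeAct_one]
  have hax : c.axial (1 : Site d → Fin d → 𝔸ˣ) = 1 := by
    show gaugeAct (c.vfix (1 : Site d → Fin d → 𝔸ˣ)) 1 = 1
    rw [hv, B8Ineq130.gaugeAct_one]
  have hlog : B8Eq138LandauZd.logCfg η (c.fixed (1 : Site d → Fin d → 𝔸ˣ) 1) = 0 := by
    rw [hf, B8Eq138LandauZd.logCfg_one]
  have hexpo : c.expo η (1 : Site d → Fin d → 𝔸ˣ) 1 = 0 := by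
    funext y τ
    show B8LeafModelZd3.mlogCfg c.k η c.sq (c.fixed (1 : Site d → Fin d → 𝔸ˣ) 1) y τ = 0
    unfold B8LeafModelZd3.mlogCfg
    split_ifs
    · rw [hlog]; rfl
    · rfl
  have hw : (c.vfix (1 : Site d → Fin d → 𝔸ˣ))⁻¹ * (1 : Site d → 𝔸ˣ) = 1 := by rw [hv, inv_one, one_mul]
  refine ⟨1, fun _ => (unitaryUnits 𝔸).one_mem, fun _ _ => rfl, B8Thm4TruncationLocal.restr129_one L c.k c.lamS 1, ?_, ?_, ?_, ?_, ?_, ?_, ?_, ?_⟩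
  · -- (1.138) for `U₁ = 1`
    rw [hf]; exact B8Eq138LandauZd.isLandau138W_one η L 1 c.k (c.sq 0) c.lamS
  · -- exponential form, Hermitian exponent, (1.136)₁ with `A = 0`
    intro j _ b _
    refine ⟨?_, ?_, ?_⟩
    · rw [hlog, hf]
      apply Units.ext
      rw [cfgExp, B7Prop1Explicit.val_expUnit]
      simp
    · rw [hlog]; exact IsSelfAdjoint.zero _
    · rw [hlog]
      simp only [Pi.zero_apply, norm_zero]
      exact mul_nonneg hr (inv_nonneg.2 (by positivity))
  · -- `w = v⁻¹u = 1` is unitary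
    intro x; rw [hw]; exact (unitaryUnits 𝔸).one_mem
  · -- (1.135): `U₀^{w⁻¹} = U₁` on `□̃` — both sides are `1`
    rw [hw, hf, inv_one, B8Ineq130.gaugeAct_one]
    intro _ _ _ _; rfl
  · -- (1.136)₂: the gradient of `A = 0`
    rw [hexpo]
    refine msup_le hr fun j _ t _ => ?_
    have : covDerivFwd η (1 : Site d → Fin d → 𝔸ˣ) t.1 (fun z => (0 : Site d → Fin d → 𝔸) z t.2.1) t.2.2 = 0 :=
      B8Eq138LandauZd.covDerivFwd_zero_fun η (1 : Site d → Fin d → 𝔸ˣ) t.1 t.2.2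
    rw [this, norm_zero, mul_zero]; exact hr
  · -- (1.136)₃: `∂^{η*}∂^η A` at `A = 0`
    rw [hexpo]
    have hplaq : plaqCovDeriv η (1 : Site d → Fin d → 𝔸ˣ) (0 : Site d → Fin d → 𝔸) = fun _ _ _ => 0 := by
      funext μ ν x
      rw [B8Eq146AExpansion.plaqCovDeriv_eq_covDerivFwd]
      rw [show (fun z => (0 : Site d → Fin d → 𝔸) z ν) = fun _ => 0 from rfl, show (fun z => (0 : Site d → Fin d → 𝔸) z μ) = fun _ => 0 from rfl,
        B8Eq138LandauZd.covDerivFwd_zero_fun, B8Eq138LandauZd.covDerivFwd_zero_fun, sub_zero]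
    have hp : (fun x μ => pdiv η (1 : Site d → Fin d → 𝔸ˣ) (plaqCovDeriv η (1 : Site d → Fin d → 𝔸ˣ) (0 : Site d → Fin d → 𝔸)) μ x) =
        (0 : Site d → Fin d → 𝔸) := by
      funext x μ; rw [hplaq]; simp [pdiv, B8Ineq132.covDeriv]
    rw [hp, bondNorm_zero]; exact hr
  · -- (1.136)₄: `Δ^η A` at `A = 0`
    rw [hexpo]
    have hl : (fun x μ => B8Eq138LandauZd.covLap η (1 : Site d → Fin d → 𝔸ˣ) (fun z => (0 : Site d → Fin d → 𝔸) z μ) x) = (0 : Site d → Fin d → 𝔸) := by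
      funext x μ; exact B8Eq138LandauZd.covLap_zero η (1 : Site d → Fin d → 𝔸ˣ) x
    rw [hl, bondNorm_zero]; exact hr
  · -- (1.137)'s identity: `Q_k(η·0) = 0 = log 1 = log Ū₀′ᵏ` for `U₀′ = 1`
    intro x μ _ _
    rw [hexpo, hax, B8Ineq132.avgIter_one]
    have h0 : iEta η (0 : Site d → Fin d → 𝔸) = 0 := by funext y κ; simp [iEta]
    rw [h0, B7Prop4GeneralCk.logCovIter_zero_field]
    simp

end FlatWitness

/-! ## §3  The carrier ∕ junction certificate: the K0 consumer's cubes lie outside the p. 98 side conditions of N05's per-cube letters -/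

section Carrier

/-- **NO CUBE WITH A THIN COLLAR MEETS «big blocks `Mh·L` divide the collar»**: if `1 ≤ c.ρ < 3L` then `¬ ∃ Mh ≥ 3, Mh·L ∣ c.ρ` (the binders `3 ≤ Mh`,
`Mh * L ∣ c.ρ` of `B8Prop6CubeMemberScalarBdryBetaPrinted.gaugedBoundB8_cubeMember_scalar_bdryβ_printed`'s p. 98 side conditions; print: «M is a multiple
of R₁M₁ … a distance between boundaries of these cubes is equal to R₁M₁Lʲη», p. 98). [cite: Balaban1985RegularSpaces, p.98 (bookkeeping)] -/
theorem not_printSide_dvd_of_rho_lt {d L K : ℕ} {Ω : ℕ → Set (Site d)} (c : CubeB8 d L K Ω) (hρ1 : 1 ≤ c.ρ) (hρ : c.ρ < 3 * L) :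
    ¬ ∃ Mh : ℕ, 3 ≤ Mh ∧ Mh * L ∣ c.ρ := by
  rintro ⟨Mh, hMh, hdvd⟩
  have h1 := Nat.le_of_dvd (by omega) hdvd
  have h2 : 3 * L ≤ Mh * L := Nat.mul_le_mul_right L hMh
  omega

/-- **NO CUBE WITH COLLAR `ρ < 6L²` MEETS «`R ≥ 2L` big blocks fit in the collar»**: `¬ ∃ Mh ≥ 3, ∃ R ≥ 2L, R·(Mh·L) ≤ c.ρ` (the binders `3 ≤ Mh`, `2L ≤ R`,
`R * (Mh * L) ≤ c.ρ` of the same side conditions). [cite: Balaban1985RegularSpaces, p.98 (bookkeeping)] -/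
theorem not_printSide_collar_of_rho_lt {d L K : ℕ} {Ω : ℕ → Set (Site d)} (c : CubeB8 d L K Ω) (hρ : c.ρ < 6 * L ^ 2) :
    ¬ ∃ Mh R : ℕ, 3 ≤ Mh ∧ 2 * L ≤ R ∧ R * (Mh * L) ≤ c.ρ := by
  rintro ⟨Mh, R, hMh, hR, hle⟩
  have h1 : 2 * L * (3 * L) ≤ R * (Mh * L) := Nat.mul_le_mul hR (Nat.mul_le_mul_right L hMh)
  nlinarith

variable (P : Params)

/-- ★ **THE K0 CONSUMER's CUBES FAIL «`Mh·L ∣ ρ`, `Mh ≥ 3`»**: every Proposition-6 datum `Node00.propCube P n hn M a` that `Node00.gauge152R_of_prop6` (via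
`exists_localGauge_cube_of_prop6`) instantiates has collar `ρ = L` (`propCube_ρ`), and `Mh·L ∣ L` with `Mh ≥ 3` is impossible (`L ≥ 2`).  Hence the
side-condition binder list of N05's per-cube letters of record is UNDISCHARGEABLE at these cubes, whatever the thresholds.
[cite: Balaban1985RegularSpaces, p.98 (bookkeeping); Balaban1985Variational, (144) p.300] -/
theorem propCube_not_printSide_dvd (n : ℕ) (hn : 1 ≤ n) (M : ℕ) (a : B14DomainGeom.Pt P.d) :
    ¬ ∃ Mh : ℕ, 3 ≤ Mh ∧ Mh * P.L ∣ (propCube P n hn M a).ρ :=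
  not_printSide_dvd_of_rho_lt (propCube P n hn M a) (by rw [propCube_ρ]; exact P.L_pos) (by rw [propCube_ρ]; have := P.L_pos; omega)

/-- ★ **THE K0 CONSUMER's CUBES FAIL «`R·(Mh·L) ≤ ρ`, `R ≥ 2L`, `Mh ≥ 3`»** (collar `ρ = L < 6L²`). [cite: Balaban1985RegularSpaces, p.98 (bookkeeping); Balaban1985Variational, (144) p.300] -/
theorem propCube_not_printSide_collar (n : ℕ) (hn : 1 ≤ n) (M : ℕ) (a : B14DomainGeom.Pt P.d) :
    ¬ ∃ Mh R : ℕ, 3 ≤ Mh ∧ 2 * P.L ≤ R ∧ R * (Mh * P.L) ≤ (propCube P n hn M a).ρ :=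
  not_printSide_collar_of_rho_lt (propCube P n hn M a) (by rw [propCube_ρ]; have := P.L_pos; nlinarith)

/-- **THE BINDER LIST AS DISPLAYED IS UNDISCHARGEABLE AT `propCube`**: for every choice of thresholds `ρ₀ M₀ : ℝ`, `N₀ : ℕ` and of the big-block data
`Mh R : ℕ`, the conjunction `3 ≤ Mh ∧ M₀ ≤ L·Mh ∧ Mh·L ∣ c.ρ ∧ Mh·L ∣ c.M ∧ R·(Mh·L) ≤ c.ρ ∧ 2L ≤ R ∧ N₀ + 1 ≤ R·(L·Mh) ∧ ρ₀ ≤ c.ρ` (the p. 98 side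
conditions of `gaugedBoundB8_cubeMember_scalar_bdryβ_printed`, in its order) FAILS at `c = propCube P n hn M a`.
[cite: Balaban1985RegularSpaces, p.98 (bookkeeping); Balaban1985Variational, (144) p.300] -/
theorem propCube_not_printSideConditions (n : ℕ) (hn : 1 ≤ n) (M : ℕ) (a : B14DomainGeom.Pt P.d) (ρ₀ M₀ : ℝ) (N₀ Mh R : ℕ) :
    ¬ (3 ≤ Mh ∧ M₀ ≤ (P.L : ℝ) * Mh ∧ Mh * P.L ∣ (propCube P n hn M a).ρ ∧ Mh * P.L ∣ (propCube P n hn M a).M ∧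
        R * (Mh * P.L) ≤ (propCube P n hn M a).ρ ∧ 2 * P.L ≤ R ∧ N₀ + 1 ≤ R * (P.L * Mh) ∧ ρ₀ ≤ ((propCube P n hn M a).ρ : ℝ)) :=
  fun h => propCube_not_printSide_dvd P n hn M a ⟨Mh, h.1, h.2.2.1⟩

end Carrier

end Summit.QuantumFields.YangMills.Theorems.K0Stub2DatumForm

end
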